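import Literature.AlgebraicGeometry.Resolution.BlowupAlgebraPresentation
import Mathlib.RingTheory.RegularLocalRing.Polynomial
import HarnessLib

/-!
# [OURS · L1 W4.5(b) · EL♮] K-COMP-LOCAL (chart `x₃`): the strict transform of `Y : x₁x₂ + x₃² = 0` under the
# `m = 1` COMPANION touch `C = V(x₂, x₃, x₁y₁ − ϖ)` is an affine `4`-space on the chart `x₃ ≠ 0`
# (crux `EquisingularLiftNat` = stmt-ResolutionOfSingularities-20038; K-∀n / K5-BMY lane, kill test #50)

HONEST FRAMING. OURS (cell res-hironaka, crux chain w45b, slot W4.5(b)); NOT a statement of any manuscript; replaces the role of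
NOTHING in the manuscript; AI-written, AI review is weaker than expert review. Helper `--supports stmt-ResolutionOfSingularities-20038
--as helper`. Object K-COMP-LOCAL of res-L1-w45b-strat-1's STRATEGY-CENSUS v10 (sha16 0ed0c3dd766d6f34) §4 (N5.2) / §5 R2″.

THE MODEL (N5.2). At a rank-`3` point `P` of a companion curve `D ⊂ S`: `Y : g = x₁x₂ + x₃² = 0` in `𝔸⁵ = Spec k[x₁,x₂,x₃,y₁,y₂]`
(`S = V(x₁,x₂,x₃)`, `D = {y₁ = 0} ⊂ S`, companion `T = V(x₂,x₃,y₁)`); the centre `C = V(x₂, x₃, x₁y₁ − ϖ) ⊂ 𝔸⁵_O` is regular,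
`O`-flat, with special fibre `C_s = S ∪_D T`. The strict transform `Ỹ` of `Y` under `Bl_C` is the blow-up of `Y` along the TRACE
`(x̄₂, x̄₃, x̄₁ȳ₁)·𝒪_Y` (Stacks 080E; `ϖ = 0` on `Y`), whose `x̄₃`-chart is the affine blow-up algebra
`B₃ := 𝒪_Y[(x̄₂, x̄₃, x̄₁ȳ₁)/x̄₃] ⊆ 𝒪_Y[1/x̄₃]` (tree `blowupAlgebra`, image model; `k` any commutative ring).

THE THEOREM (N5.2 «chart `x₃` (`x₂ = x₃c`, `w = x₃d`): `Ỹ = V(x₃ + x₁c, y₁ + cd)`, regular»), here sorry-free and def-free: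
the evaluation `ψ₃ : k[x₁, c, d, y₂] → B₃`, `c ↦ x̄₂/x̄₃`, `d ↦ x̄₁ȳ₁/x̄₃`, is a BIJECTION (`chart3_bijective`; the ring isomorphism
`k[x₁,c,d,y₂] ≅ B₃` is `RingEquiv.ofBijective _ (chart3_bijective k)`), the two relations `x̄₃ = −x̄₁·c`, `ȳ₁ = −c·d` hold in
`B₃` (`algebraMap_x₃_eq`, `algebraMap_y₁_eq`), and for a field `k` the chart `B₃` is a regular ring (`isRegularRing_chart3`).
Proof: onto because every generator `x̄ⱼ` of `𝒪_Y` and every fraction is hit (the two relations follow from `x̄₃² = −x̄₁x̄₂`,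
`blowupAlgebra.eval_surjective`); injective by the left inverse `𝒪_Y[1/x̄₃] → k[x₁,c,d,y₂][1/(x₁c)]`, `x₂ ↦ −x₁c²`,
`x₃ ↦ −x₁c`, `y₁ ↦ −cd`. Charts `x₂` and `w` are the sequel file. Coordinates: `X 0,…,X 4 = x₁, x₂, x₃, y₁, y₂` on `𝔸⁵`,
`X 0,…,X 3 = x₁, c, d, y₂` on the model.

References: res-L1-w45b-strat-1 STRATEGY-CENSUS v10 N5.2; [StacksProject, Tags 052P/052Q/080E]; [GortzWedhorn2020, (13.19) p. 415].
-/

set_option linter.dupNamespace false -- mandated namespace `Summit.<Summit>.<Problem>` of this single-conjunct summit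

noncomputable section

universe u

open Literature.AlgebraicGeometry.Resolution MvPolynomial

namespace Summit.ResolutionOfSingularities.ResolutionOfSingularities.Cruxes.EquisingularLiftNat.Sections

namespace CompanionModel

/-! ## Two identities in any commutative ring -/

/-- `a₃ e = 1`, `a₃² = −a₁a₂` ⇒ `a₃ = −a₁·(a₂e)`. [folklore] -/
theorem rel_x₃ {L : Type*} [CommRing L] (a₁ a₂ a₃ e : L) (he : a₃ * e = 1) (hg : a₃ ^ 2 = -(a₁ * a₂)) :
    a₃ = -(a₁ * (a₂ * e)) := by
  calc a₃ = a₃ * (a₃ * e) := by rw [he, mul_one]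
    _ = a₃ ^ 2 * e := by ring
    _ = -(a₁ * a₂) * e := by rw [hg]
    _ = -(a₁ * (a₂ * e)) := by ring

/-- `a₃ e = 1`, `a₃² = −a₁a₂` ⇒ `b₁ = −(a₂e)·((a₁b₁)e)`. [folklore] -/
theorem rel_y₁ {L : Type*} [CommRing L] (a₁ a₂ a₃ b₁ e : L) (he : a₃ * e = 1) (hg : a₃ ^ 2 = -(a₁ * a₂)) :
    b₁ = -(a₂ * e * (a₁ * b₁ * e)) := by
  calc b₁ = b₁ * (a₃ * e) ^ 2 := by rw [he, one_pow, mul_one]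
    _ = b₁ * a₃ ^ 2 * e ^ 2 := by ring
    _ = b₁ * (-(a₁ * a₂)) * e ^ 2 := by rw [hg]
    _ = -(a₂ * e * (a₁ * b₁ * e)) := by ring

/-- `a₂ = a₃·(a₂ e)` when `a₃ e = 1`. [folklore] -/
theorem rel_x₂ {L : Type*} [CommRing L] (a₂ a₃ e : L) (he : a₃ * e = 1) : a₂ = a₃ * (a₂ * e) := by
  calc a₂ = a₂ * (a₃ * e) := by rw [he, mul_one]
    _ = a₃ * (a₂ * e) := by ring

variable (k : Type u) [CommRing k]

/-- The equation `g = x₁x₂ + x₃²` of `Y` (coordinates `X 0, …, X 4 = x₁, x₂, x₃, y₁, y₂`). OURS bookkeeping. -/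
def gY : MvPolynomial (Fin 5) k := X 0 * X 1 + X 2 ^ 2

/-- `𝒪_Y = k[x₁,x₂,x₃,y₁,y₂]/(x₁x₂ + x₃²)`. OURS bookkeeping. -/
abbrev OY : Type u := MvPolynomial (Fin 5) k ⧸ Ideal.span {gY k}

/-- `k[x] → 𝒪_Y`. OURS bookkeeping. -/
abbrev mkY : MvPolynomial (Fin 5) k →+* OY k := Ideal.Quotient.mk (Ideal.span {gY k})

/-- The trace family `(x̄₂, x̄₃, x̄₁ȳ₁)` on `Y` of the companion centre `C = V(x₂, x₃, x₁y₁ − ϖ)`. OURS bookkeeping. -/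
def tr : Fin 3 → OY k := ![mkY k (X 1), mkY k (X 2), mkY k (X 0 * X 3)]

/-- The chart `B₃ = 𝒪_Y[(x̄₂, x̄₃, x̄₁ȳ₁)/x̄₃] ⊆ 𝒪_Y[1/x̄₃]` of the blow-up of `Y` along the trace (tree `blowupAlgebra`). OURS bookkeeping. -/
abbrev B₃ : Subalgebra (OY k) (Localization.Away (tr k 1)) := blowupAlgebra (Ideal.span (Set.range (tr k))) (tr k 1)

/-- The values of the model coordinates `x₁, c, d, y₂` in `B₃`: `x̄₁`, `x̄₂/x̄₃`, `x̄₁ȳ₁/x̄₃`, `ȳ₂`. OURS bookkeeping. -/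
def cv : Fin 4 → B₃ k :=
  ![algebraMap (OY k) (B₃ k) (mkY k (X 0)), blowupAlgebra.frac (tr k) 1 0, blowupAlgebra.frac (tr k) 1 2,
    algebraMap (OY k) (B₃ k) (mkY k (X 4))]

/-- **`ψ₃ : k[x₁, c, d, y₂] → B₃`**, `c ↦ x̄₂/x̄₃`, `d ↦ x̄₁ȳ₁/x̄₃` (model coordinates `X 0, …, X 3 = x₁, c, d, y₂`). OURS bookkeeping. -/
def ψ₃ : MvPolynomial (Fin 4) k →+* B₃ k :=
  MvPolynomial.eval₂Hom ((algebraMap (OY k) (B₃ k)).comp ((mkY k).comp MvPolynomial.C)) (cv k)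

/-! ## The relations in `𝒪_Y` and `𝒪_Y[1/x̄₃]` -/

/-- `x̄₃² = −x̄₁x̄₂` in `𝒪_Y`. [folklore] -/
theorem sq_x₃_eq : mkY k (X 2) ^ 2 = -(mkY k (X 0) * mkY k (X 1)) := by
  rw [← map_mul, ← map_pow, ← map_neg, Ideal.Quotient.eq, Ideal.mem_span_singleton]
  exact ⟨1, by rw [gY]; ring⟩

/-- `x̄₃ · (1/x̄₃) = 1` in `𝒪_Y[1/x̄₃]`. [folklore] -/
theorem x₃_mul_invSelf :
    algebraMap (OY k) (Localization.Away (tr k 1)) (tr k 1) * IsLocalization.Away.invSelf (tr k 1) = 1 :=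
  IsLocalization.Away.mul_invSelf (S := Localization.Away (tr k 1)) (tr k 1)

/-- `x̄₃² = −x̄₁x̄₂` in `𝒪_Y[1/x̄₃]`. [folklore] -/
theorem sq_x₃_eq_loc :
    algebraMap (OY k) (Localization.Away (tr k 1)) (tr k 1) ^ 2 =
      -(algebraMap (OY k) (Localization.Away (tr k 1)) (mkY k (X 0)) *
        algebraMap (OY k) (Localization.Away (tr k 1)) (mkY k (X 1))) := by
  change algebraMap (OY k) (Localization.Away (tr k 1)) (mkY k (X 2)) ^ 2 = _
  rw [← map_pow, sq_x₃_eq, map_neg, map_mul]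

/-! ## `ψ₃` on generators; the two relations `x̄₃ = −x̄₁c`, `ȳ₁ = −cd` in `B₃` -/

/-- `ψ₃` on constants. [folklore] -/
theorem ψ₃_C (a : k) : ψ₃ k (C a) = algebraMap (OY k) (B₃ k) (mkY k (C a)) := MvPolynomial.eval₂Hom_C _ _ a

/-- `ψ₃ x₁ = x̄₁`. [folklore] -/
theorem ψ₃_X₀ : ψ₃ k (X 0) = algebraMap (OY k) (B₃ k) (mkY k (X 0)) := MvPolynomial.eval₂Hom_X' _ _ 0

/-- `ψ₃ c = x̄₂/x̄₃`. [folklore] -/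
theorem ψ₃_X₁ : ψ₃ k (X 1) = blowupAlgebra.frac (tr k) 1 0 := MvPolynomial.eval₂Hom_X' _ _ 1

/-- `ψ₃ d = x̄₁ȳ₁/x̄₃`. [folklore] -/
theorem ψ₃_X₂ : ψ₃ k (X 2) = blowupAlgebra.frac (tr k) 1 2 := MvPolynomial.eval₂Hom_X' _ _ 2

/-- `ψ₃ y₂ = ȳ₂`. [folklore] -/
theorem ψ₃_X₃ : ψ₃ k (X 3) = algebraMap (OY k) (B₃ k) (mkY k (X 4)) := MvPolynomial.eval₂Hom_X' _ _ 3

/-- **N5.2, first relation on the chart: `x̄₃ = −x̄₁·c` in `B₃`.** [folklore] -/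
theorem algebraMap_x₃_eq : algebraMap (OY k) (B₃ k) (tr k 1) = -(ψ₃ k (X 0) * ψ₃ k (X 1)) := by
  rw [ψ₃_X₀, ψ₃_X₁]
  apply Subtype.ext
  rw [Subalgebra.coe_neg, Subalgebra.coe_mul, blowupAlgebra.coe_frac]
  exact rel_x₃ _ _ _ _ (x₃_mul_invSelf k) (sq_x₃_eq_loc k)

/-- **N5.2, second relation on the chart: `ȳ₁ = −c·d` in `B₃`.** [folklore] -/
theorem algebraMap_y₁_eq : algebraMap (OY k) (B₃ k) (mkY k (X 3)) = -(ψ₃ k (X 1) * ψ₃ k (X 2)) := by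
  rw [ψ₃_X₁, ψ₃_X₂]
  apply Subtype.ext
  rw [Subalgebra.coe_neg, Subalgebra.coe_mul, blowupAlgebra.coe_frac, blowupAlgebra.coe_frac]
  have h := rel_y₁ _ _ _ (algebraMap (OY k) (Localization.Away (tr k 1)) (mkY k (X 3))) _ (x₃_mul_invSelf k)
    (sq_x₃_eq_loc k)
  rwa [← map_mul] at h

/-- `x̄₂ = x̄₃ · c = −x̄₁c·c` in `B₃`. [folklore] -/
theorem algebraMap_x₂_eq : algebraMap (OY k) (B₃ k) (mkY k (X 1)) = -(ψ₃ k (X 0) * ψ₃ k (X 1)) * ψ₃ k (X 1) := by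
  rw [← algebraMap_x₃_eq, ψ₃_X₁]
  apply Subtype.ext
  rw [Subalgebra.coe_mul, blowupAlgebra.coe_frac]
  exact rel_x₂ _ _ _ (x₃_mul_invSelf k)

/-! ## `ψ₃` is onto -/

/-- Every `x̄ⱼ` lies in the image of `ψ₃`. [folklore] -/
theorem algebraMap_X_mem_range (j : Fin 5) : algebraMap (OY k) (B₃ k) (mkY k (X j)) ∈ (ψ₃ k).range := by
  have h2 : algebraMap (OY k) (B₃ k) (mkY k (X 2)) ∈ (ψ₃ k).range :=
    ⟨-(X 0 * X 1), by rw [map_neg, map_mul, ← algebraMap_x₃_eq]; rfl⟩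
  match j with
  | ⟨0, _⟩ => exact ⟨X 0, ψ₃_X₀ k⟩
  | ⟨1, _⟩ =>
    exact (show algebraMap (OY k) (B₃ k) (mkY k (X 1)) ∈ (ψ₃ k).range from
      ⟨-(X 0 * X 1) * X 1, by rw [map_mul, map_neg, map_mul, algebraMap_x₂_eq]⟩)
  | ⟨2, _⟩ => exact h2
  | ⟨3, _⟩ =>
    exact (show algebraMap (OY k) (B₃ k) (mkY k (X 3)) ∈ (ψ₃ k).range from
      ⟨-(X 1 * X 2), by rw [map_neg, map_mul, ← algebraMap_y₁_eq]⟩)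
  | ⟨4, _⟩ => exact ⟨X 3, ψ₃_X₃ k⟩

/-- Every constant `𝒪_Y → B₃` lies in the image of `ψ₃`. [folklore] -/
theorem algebraMap_mem_range (y : OY k) : algebraMap (OY k) (B₃ k) y ∈ (ψ₃ k).range := by
  obtain ⟨G, rfl⟩ := Ideal.Quotient.mk_surjective y
  induction G using MvPolynomial.induction_on with
  | C a => exact ⟨C a, ψ₃_C k a⟩
  | add p q hp hq => rw [map_add, map_add]; exact add_mem hp hq
  | mul_X p j hp => rw [map_mul, map_mul]; exact mul_mem hp (algebraMap_X_mem_range k j)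

/-- Every fraction `x/x̄₃`, `x` in the trace family, lies in the image of `ψ₃`. [folklore] -/
theorem frac_mem_range (j : Fin 3) : blowupAlgebra.frac (tr k) 1 j ∈ (ψ₃ k).range := by
  have h1 : blowupAlgebra.frac (tr k) 1 1 ∈ (ψ₃ k).range := by
    refine ⟨1, ?_⟩
    rw [map_one]
    apply Subtype.ext
    rw [blowupAlgebra.coe_frac, OneMemClass.coe_one]
    exact (x₃_mul_invSelf k).symm
  match j with
  | ⟨0, _⟩ => exact ⟨X 1, ψ₃_X₁ k⟩
  | ⟨1, _⟩ => exact h1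
  | ⟨2, _⟩ => exact ⟨X 2, ψ₃_X₂ k⟩

/-- **`ψ₃` is onto** (`B₃` is generated over `𝒪_Y` by the fractions: `blowupAlgebra.eval_surjective`). [folklore] -/
theorem ψ₃_surjective : Function.Surjective (ψ₃ k) := by
  intro z
  obtain ⟨F, rfl⟩ := blowupAlgebra.eval_surjective (tr k) 1 z
  suffices h : (blowupAlgebra.eval (tr k) 1 F) ∈ (ψ₃ k).range by exact h
  induction F using MvPolynomial.induction_on with
  | C y => rw [blowupAlgebra.eval_C]; exact algebraMap_mem_range k y
  | add p q hp hq => rw [map_add]; exact add_mem hp hq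
  | mul_X p j hp => rw [map_mul, blowupAlgebra.eval_X]; exact mul_mem hp (frac_mem_range k j.1)

/-! ## `ψ₃` is injective: the left inverse `𝒪_Y[1/x̄₃] → k[x₁,c,d,y₂][1/(x₁c)]` -/

/-- The substitution `x₁ ↦ x₁, x₂ ↦ −x₁c², x₃ ↦ −x₁c, y₁ ↦ −cd, y₂ ↦ y₂` (the inverse chart map). OURS bookkeeping. -/
def lamVal : Fin 5 → MvPolynomial (Fin 4) k := ![X 0, -(X 0 * X 1 ^ 2), -(X 0 * X 1), -(X 1 * X 2), X 3]

/-- `x₁ ↦ x₁`. [folklore] -/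
theorem lamVal_zero : lamVal k 0 = X 0 := rfl

/-- `x₂ ↦ −x₁c²`. [folklore] -/
theorem lamVal_one : lamVal k 1 = -(X 0 * X 1 ^ 2) := rfl

/-- `x₃ ↦ −x₁c`. [folklore] -/
theorem lamVal_two : lamVal k 2 = -(X 0 * X 1) := rfl

/-- `y₁ ↦ −cd`. [folklore] -/
theorem lamVal_three : lamVal k 3 = -(X 1 * X 2) := rfl

/-- `y₂ ↦ y₂`. [folklore] -/
theorem lamVal_four : lamVal k 4 = X 3 := rfl

/-- The substitution kills `g`: `x₁·(−x₁c²) + (−x₁c)² = 0`. [folklore] -/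
theorem subst_gY : MvPolynomial.eval₂Hom MvPolynomial.C (lamVal k) (gY k) = 0 := by
  simp only [gY, map_add, map_mul, map_pow, MvPolynomial.eval₂Hom_X', lamVal_zero, lamVal_one, lamVal_two]
  ring

/-- `λ₁ : 𝒪_Y → k[x₁,c,d,y₂][1/(x₁c)]`. OURS bookkeeping. -/
def lam₁ : OY k →+* Localization.Away (X 0 * X 1 : MvPolynomial (Fin 4) k) :=
  Ideal.Quotient.lift (Ideal.span {gY k})
    ((algebraMap (MvPolynomial (Fin 4) k) (Localization.Away (X 0 * X 1 : MvPolynomial (Fin 4) k))).comp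
      (MvPolynomial.eval₂Hom MvPolynomial.C (lamVal k)))
    (fun a ha => by
      obtain ⟨b, rfl⟩ := Ideal.mem_span_singleton'.mp ha
      rw [RingHom.comp_apply, map_mul, subst_gY, mul_zero, map_zero])

/-- `λ₁` on classes. [folklore] -/
theorem lam₁_mkY (F : MvPolynomial (Fin 5) k) :
    lam₁ k (mkY k F) = algebraMap (MvPolynomial (Fin 4) k) (Localization.Away (X 0 * X 1 : MvPolynomial (Fin 4) k))
      (MvPolynomial.eval₂Hom MvPolynomial.C (lamVal k) F) :=
  Ideal.Quotient.lift_mk _ _ _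

/-- `λ₁(x̄₃) = −x₁c`. [folklore] -/
theorem lam₁_tr_one : lam₁ k (tr k 1) =
    -algebraMap (MvPolynomial (Fin 4) k) (Localization.Away (X 0 * X 1 : MvPolynomial (Fin 4) k)) (X 0 * X 1) := by
  change lam₁ k (mkY k (X 2)) = _
  rw [lam₁_mkY, MvPolynomial.eval₂Hom_X', ← map_neg, lamVal_two]

/-- `λ₁(x̄₃) = −x₁c` is a unit of `k[x₁,c,d,y₂][1/(x₁c)]`. [folklore] -/
theorem isUnit_lam₁_tr_one : IsUnit (lam₁ k (tr k 1)) := by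
  rw [lam₁_tr_one]
  exact (IsLocalization.Away.algebraMap_isUnit (X 0 * X 1 : MvPolynomial (Fin 4) k)).neg

/-- **`Λ₃ : 𝒪_Y[1/x̄₃] → k[x₁,c,d,y₂][1/(x₁c)]`**, the left inverse of `ψ₃` after localisation. OURS bookkeeping. -/
def Λ₃ : Localization.Away (tr k 1) →+* Localization.Away (X 0 * X 1 : MvPolynomial (Fin 4) k) :=
  IsLocalization.Away.lift (tr k 1) (isUnit_lam₁_tr_one k)

/-- `Λ₃` extends `λ₁`. [folklore] -/
theorem Λ₃_algebraMap (y : OY k) : Λ₃ k (algebraMap (OY k) (Localization.Away (tr k 1)) y) = lam₁ k y :=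
  IsLocalization.Away.lift_eq (tr k 1) (isUnit_lam₁_tr_one k) y

/-- `Λ₃` on a fraction `r/x̄₃`: if `λ₁ r = t · λ₁ x̄₃` then `Λ₃ (r/x̄₃) = t`. [folklore] -/
theorem Λ₃_frac {r : OY k} {t : Localization.Away (X 0 * X 1 : MvPolynomial (Fin 4) k)} (h : lam₁ k r = t * lam₁ k (tr k 1)) :
    Λ₃ k (algebraMap (OY k) (Localization.Away (tr k 1)) r * IsLocalization.Away.invSelf (tr k 1)) = t := by
  refine (isUnit_lam₁_tr_one k).mul_left_injective ?_
  dsimp only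
  rw [← h, ← Λ₃_algebraMap k (tr k 1), ← map_mul, mul_assoc, mul_comm (IsLocalization.Away.invSelf (tr k 1)),
    x₃_mul_invSelf, mul_one, Λ₃_algebraMap]

/-- **`Λ₃ ∘ ψ₃ = (k[x₁,c,d,y₂] → k[x₁,c,d,y₂][1/(x₁c)])`.** [folklore] -/
theorem Λ₃_comp_ψ₃ :
    (Λ₃ k).comp (((B₃ k).val : B₃ k →+* Localization.Away (tr k 1)).comp (ψ₃ k)) =
      algebraMap (MvPolynomial (Fin 4) k) (Localization.Away (X 0 * X 1 : MvPolynomial (Fin 4) k)) := by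
  refine MvPolynomial.ringHom_ext (fun a => ?_) (fun j => ?_)
  · rw [RingHom.comp_apply, RingHom.comp_apply, ψ₃_C]
    change Λ₃ k (algebraMap (OY k) (Localization.Away (tr k 1)) (mkY k (C a))) = _
    rw [Λ₃_algebraMap, lam₁_mkY, MvPolynomial.eval₂Hom_C]
  · rw [RingHom.comp_apply, RingHom.comp_apply]
    match j with
    | ⟨0, _⟩ =>
      change Λ₃ k ((ψ₃ k (X 0) : B₃ k) : Localization.Away (tr k 1)) = algebraMap _ _ (X 0)
      rw [ψ₃_X₀]
      change Λ₃ k (algebraMap (OY k) (Localization.Away (tr k 1)) (mkY k (X 0))) = _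
      rw [Λ₃_algebraMap, lam₁_mkY, MvPolynomial.eval₂Hom_X']
      rfl
    | ⟨1, _⟩ =>
      change Λ₃ k ((ψ₃ k (X 1) : B₃ k) : Localization.Away (tr k 1)) = algebraMap _ _ (X 1)
      rw [ψ₃_X₁, blowupAlgebra.coe_frac]
      refine Λ₃_frac k ?_
      change lam₁ k (mkY k (X 1)) = _
      rw [lam₁_tr_one, lam₁_mkY, MvPolynomial.eval₂Hom_X', mul_neg, ← map_mul, ← map_neg]
      congr 1
      rw [lamVal_one]
      ring
    | ⟨2, _⟩ =>
      change Λ₃ k ((ψ₃ k (X 2) : B₃ k) : Localization.Away (tr k 1)) = algebraMap _ _ (X 2)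
      rw [ψ₃_X₂, blowupAlgebra.coe_frac]
      refine Λ₃_frac k ?_
      change lam₁ k (mkY k (X 0 * X 3)) = _
      rw [lam₁_tr_one, lam₁_mkY, map_mul, MvPolynomial.eval₂Hom_X', MvPolynomial.eval₂Hom_X', mul_neg, ← map_mul,
        ← map_neg]
      congr 1
      rw [lamVal_zero, lamVal_three]
      ring
    | ⟨3, _⟩ =>
      change Λ₃ k ((ψ₃ k (X 3) : B₃ k) : Localization.Away (tr k 1)) = algebraMap _ _ (X 3)
      rw [ψ₃_X₃]
      change Λ₃ k (algebraMap (OY k) (Localization.Away (tr k 1)) (mkY k (X 4))) = _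
      rw [Λ₃_algebraMap, lam₁_mkY, MvPolynomial.eval₂Hom_X']
      rfl

/-- **`ψ₃` is injective** (`k` a domain). [folklore] -/
theorem ψ₃_injective [IsDomain k] : Function.Injective (ψ₃ k) := by
  have hne : (X 0 * X 1 : MvPolynomial (Fin 4) k) ≠ 0 := mul_ne_zero (MvPolynomial.X_ne_zero 0) (MvPolynomial.X_ne_zero 1)
  have hinj : Function.Injective
      (algebraMap (MvPolynomial (Fin 4) k) (Localization.Away (X 0 * X 1 : MvPolynomial (Fin 4) k))) :=
    IsLocalization.injective _ (powers_le_nonZeroDivisors_of_noZeroDivisors hne)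
  rw [← Λ₃_comp_ψ₃, RingHom.coe_comp, RingHom.coe_comp] at hinj
  exact hinj.of_comp.of_comp

/-! ## Conclusion -/

/-- **K-COMP-LOCAL, chart `x₃` (N5.2): `ψ₃ : k[x₁, c, d, y₂] → B₃ = 𝒪_Y[(x̄₂,x̄₃,x̄₁ȳ₁)/x̄₃]` is a bijection** — the chart
`x₃ ≠ 0` of the strict transform of `Y : x₁x₂ + x₃² = 0` under the companion touch is an affine `4`-space, with `x̄₃ = −x̄₁c` and
`ȳ₁ = −cd` (`algebraMap_x₃_eq`, `algebraMap_y₁_eq`). OURS. -/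
theorem ψ₃_bijective [IsDomain k] : Function.Bijective (ψ₃ k) :=
  ⟨ψ₃_injective k, ψ₃_surjective k⟩

/-- **The chart `B₃` is a regular ring** (over a field): `B₃ ≅ k[x₁, c, d, y₂]`. OURS. -/
theorem isRegularRing_B₃ (K : Type u) [Field K] : IsRegularRing (B₃ K) :=
  IsRegularRing.of_ringEquiv (RingEquiv.ofBijective (ψ₃ K) (ψ₃_bijective K))

end CompanionModel

end Summit.ResolutionOfSingularities.ResolutionOfSingularities.Cruxes.EquisingularLiftNat.Sections
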